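import Literature.NumberTheory.Sieve.RosserSieveHalfLemma17
import Literature.NumberTheory.Sieve.BetaSieveSmallDimension
import HarnessLib

/-!
# Iwaniec's Lemma 18 in dimension `1/2` (`β = 1`): the named fact `Iwaniec1980_lemma18_half` holds

Topic `Literature/NumberTheory/Sieve`; Iwaniec, *Rosser's sieve*, Acta Arith. 36 (1980), §7, Lemma 18
("The series (7.1) and (7.2) converge and the limit functions `T^±(s)` satisfy `0 < T^±(s) ≪ s^{κ+1} Q^±(s)`,
(7.7)") together with p. 202 (`F(s) = 1 + s^{−κ} T⁺(s)`, `f(s) = 1 − s^{−κ} T⁻(s)`), in the boundary case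
`κ = 1/2`, where Iwaniec's parameter is `β = β_{1/2} = 1` (§7, p. 193) and the kernel
`k(t) = κ t^{κ−1} (t − 1)^{−κ}` of (7.3) is singular (but integrable) at the sieving threshold `t = 1`.
`RosserSieveLemma18.lean` proves Lemma 18 for `κ > 1/2` (`β > 1`, regular kernel) and isolates the case
`κ = 1/2` as the named fact `BetaSieve.Iwaniec1980_lemma18_half`; this file DISCHARGES it
(`BetaSieve.Iwaniec1980_lemma18_half_holds`), so that `Iwaniec1980_lemma18` (`RosserSieveSums.lean`) is now a
theorem for every `κ ≥ 1/2` (`BetaSieve.Iwaniec1980_lemma18_holds`) and the corrected form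
`SieveSequence.Iwaniec1980_lower` / `Iwaniec1980_upper` of Iwaniec's Theorem 1 (the correction of the
refuted `SieveSequence.jurkat_richert_lower` / `jurkat_richert_upper` of `SieveFunctions.lean`) rests on the
single named fact `Iwaniec1980_lemma20` (`Iwaniec1980_lemma20.sieveSequence_lower`, `.sieveSequence_upper`).

## The argument (Iwaniec, pp. 195–196 and 202, carried out at `β = 1`)

The input is Lemma 17 at `κ = 1/2` (`BetaSieve.exists_const_contT_le_half`, `RosserSieveHalfLemma17.lean`):
`T⁻_N(s) ≤ c Z⁻(s)` for `s ≥ 1` and `T⁺_N(s) ≤ c Z⁺(s)` for `s ≥ 0`, uniformly in `N`, where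
`T^∓_N = BetaSieve.contT 0/1 (1/2) 1 N` are the partial sums (7.1)–(7.2) at `β = 1` and `Z^± = qUpper/qLower 1 2`
are the linear-sieve majorants ((7.5): "a `q^±` corresponding to some `κ₁ > 1/2`").

* Limits and (7.7): `T^± = contTLim` exist; by monotone convergence from (7.3) at `β = 1`
  (`RosserSieveRecurrencesBetaOne.lean`), with the integrable dominating functions `c k(t) Z^±(t − 1)`
  (`∫_s^U k Z⁺(· − 1) ≤ 1`, `∫_s^U k Z⁻(· − 1) ≤ 1/2` uniformly), `T⁻(s) = ∫_s^∞ k(t) T⁺(t − 1) dt` for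
  `s ≥ 1` (singular lower limit allowed: `tendsto_setIntegral_sieveKernel_mul_of_one_le`),
  `T⁺(s) = ∫_s^∞ k(t) T⁻(t − 1) dt` for `s ≥ 2`, and `T⁺(s) + s^{1/2} = 2^{1/2} + T⁺(2)` on `(0, 2]`.
* Regularity: `T⁺` is continuous on `(0, ∞)`, `T⁻` on `[1, ∞)`; `(T⁻)' = −k T⁺(· − 1)` on `(1, ∞)`,
  `(T⁺)' = −k T⁻(· − 1)` on `(2, ∞)`.
* Candidates (p. 202): `F̃ = candUpper (1/2) 1 = 1 + s^{−1/2} T⁺`, `f̃ = candLower (1/2) 1`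
  (`= 1 − s^{−1/2} T⁻` for `s > 1`, `= B̃ s^{−1/2}` on `(0, 1]`, `B̃ = candB (1/2) 1 = 1 − T⁻(1)`),
  `Ã = candConst (1/2) 1 = 2^{1/2} + T⁺(2)`: they satisfy (1.8)–(1.9) with `β = 1`, and
  `F̃, f̃ = 1 + O(e^{−s})` by the decay of `Z^±` (`majorantHyp_one_two`).
* `B̃ = 0` (p. 196: "Thus `B = 0`"): the adjoint of dimension `1/2` is `g ≡ 1` (`SieveAdjoint.qFun_half`), and the
  inner product `⟨Q̃, 1⟩(s) = s Q̃(s) − (1/2) ∫_{s−1}^s Q̃` of `Q̃ = F̃ − f̃` has derivative `0` beyond `2` and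
  `−(1/2) B̃ (s − 1)^{−1/2}` on `(1, 2)`, tends to `0` at infinity (`Q̃ = O(e^{−s})`), hence vanishes on
  `[2, ∞)` and equals `B̃ (1 − (s − 1)^{1/2})` on `(1, 2)`; comparing with the direct evaluation as `s → 1⁺`
  (`s Q̃(s) → T⁺(1) + T⁻(1) = Ã − B̃`, `∫_{s−1}^1 Q̃ = 2(Ã − B̃)(1 − (s − 1)^{1/2})`, `∫_1^s Q̃ → 0`)
  gives `B̃ = 0`. (For `β > 1` Iwaniec evaluates the pairing at `s = β`; at `β = 1` the value at the
  threshold is a limit, (7.12) with `β − 1 = 0`.)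
* Identification: `(F̃, f̃, 1, Ã)` is a normalised solution of dimension `1/2`; the greatest data of dimension
  `1/2` have `β = 1` (`IsBetaSieveSolution.beta_eq_one`), so `F = F̃`, `f = f̃` on `(0, ∞)`
  (`IsBetaSieveSolution.unique_of_beta_eq`), and `T^±_N ≤ T^± = s^{1/2}(F − 1)`, `s^{1/2}(1 − f)`
  (`T⁻(1) = 1` because `B̃ = 0`).

Everything here is PROVED (standard axioms); no new definitions.

## References

* H. Iwaniec, *Rosser's sieve*, Acta Arith. 36 (1980), 171–202: §7, (7.1)–(7.7), Lemmas 17–18, (7.10)–(7.12),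
  p. 196; §9, p. 202. [IwaniecActaArith1980]
* G. Greaves, *Sieves in Number Theory*, Springer (2001), §4.2.2 (2.4), §4.2.3 (3.3) (`q = 1` at level `1`),
  §4.3.3 (the case `κ ≤ 1/2`). [Greaves2001]
-/

open Filter Set MeasureTheory intervalIntegral Asymptotics
open scoped Topology

noncomputable section

namespace Literature.NumberTheory.Sieve

namespace BetaSieve

open BetaSieveForward (sieveKernel sieveKernel_nonneg continuousOn_sieveKernel)
open RosserMajorant SieveAdjoint

/-! ### Set integrals over `(s, ∞)` of compactly supported integrands -/

/-- A set integral over `(s, ∞)` of a function integrable on `(s, U]` and vanishing on `[U, ∞)` is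
the interval integral over `[s, U]` (integrable version of `setIntegral_Ioi_eq_intervalIntegral`).
[folklore] -/
theorem setIntegral_Ioi_eq_intervalIntegral_of_integrableOn {f : ℝ → ℝ} {s U : ℝ} (hsU : s ≤ U)
    (hf : IntegrableOn f (Ioc s U) volume) (hzero : ∀ t, U ≤ t → f t = 0) :
    ∫ t in Ioi s, f t = ∫ t in s..U, f t := by
  have h2 : IntegrableOn f (Ioi U) volume :=
    (integrableOn_zero).congr_fun (fun t (ht : U < t) => (hzero t ht.le).symm) measurableSet_Ioi
  rw [← Ioc_union_Ioi_eq_Ioi hsU, setIntegral_union (Ioc_disjoint_Ioi_same) measurableSet_Ioi hf h2,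
    intervalIntegral.integral_of_le hsU,
    setIntegral_congr_fun measurableSet_Ioi (fun t (ht : U < t) => hzero t ht.le), integral_zero,
    add_zero]

/-- Integrability on `(s, ∞)` of a function integrable on `(s, U]` and vanishing on `[U, ∞)`.
[folklore] -/
theorem integrableOn_Ioi_of_integrableOn_of_support {f : ℝ → ℝ} {s U : ℝ} (hsU : s ≤ U)
    (hf : IntegrableOn f (Ioc s U) volume) (hzero : ∀ t, U ≤ t → f t = 0) :
    IntegrableOn f (Ioi s) volume := by
  have h2 : IntegrableOn f (Ioi U) volume :=
    (integrableOn_zero).congr_fun (fun t (ht : U < t) => (hzero t ht.le).symm) measurableSet_Ioi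
  rw [← Ioc_union_Ioi_eq_Ioi hsU]
  exact hf.union h2

/-- **Monotone convergence for the recurrences at the sieving threshold** (`β = 1`, `0 ≤ κ < 1`,
`s ≥ 1`; the kernel `k(t) = κ t^{κ−1} (t − 1)^{−κ}` may be singular at the lower limit): if
`φ_N(u) ↑ Φ(u)` for `u > s − 1` (`φ_N` continuous, vanishing for `u ≥ 1 + N`), and `k(t) Φ(t − 1)` is
dominated on `(s, ∞)` by an integrable `g`, then
`∫_{(s,∞)} k(t) φ_N(t − 1) dt → ∫_{(s,∞)} k(t) Φ(t − 1) dt`. [folklore] -/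
theorem tendsto_setIntegral_sieveKernel_mul_of_one_le {κ : ℝ} (hκ : 0 ≤ κ) (hκ1 : κ < 1) {s : ℝ}
    (hs : 1 ≤ s) {φ : ℕ → ℝ → ℝ} {Φ : ℝ → ℝ} (hφc : ∀ N, Continuous (φ N))
    (hzero : ∀ (N : ℕ) (t : ℝ), 1 + N ≤ t - 1 → φ N (t - 1) = 0)
    (hmono : ∀ t, s < t → Monotone fun N => φ N (t - 1))
    (hlim : ∀ t, s < t → Tendsto (fun N => φ N (t - 1)) atTop (𝓝 (Φ (t - 1))))
    {g : ℝ → ℝ} (hg : IntegrableOn g (Ioi s) volume)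
    (hdom : ∀ t, s < t → |sieveKernel κ t * Φ (t - 1)| ≤ g t) :
    Tendsto (fun N => ∫ t in Ioi s, sieveKernel κ t * φ N (t - 1)) atTop
      (𝓝 (∫ t in Ioi s, sieveKernel κ t * Φ (t - 1))) := by
  have hint : ∀ N, Integrable (fun t => sieveKernel κ t * φ N (t - 1)) (volume.restrict (Ioi s)) := by
    intro N
    set U := max s (1 + N + 1) with hU
    have hsU : s ≤ U := le_max_left _ _
    have hI : IntervalIntegrable (fun t => sieveKernel κ t * φ N (t - 1)) volume s U :=
      intervalIntegrable_sieveKernel_mul_of_one_le hκ1 (hφc N) hs hsU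
    exact integrableOn_Ioi_of_integrableOn_of_support hsU hI.1 fun t ht => by
      rw [hzero N t (by linarith [le_max_right s (1 + (N : ℝ) + 1)]), mul_zero]
  have hmeas : AEStronglyMeasurable (fun t => sieveKernel κ t * Φ (t - 1))
      (volume.restrict (Ioi s)) := by
    refine aestronglyMeasurable_of_tendsto_ae atTop (fun N => (hint N).aestronglyMeasurable) ?_
    refine (ae_restrict_mem measurableSet_Ioi).mono fun t (ht : s < t) => ?_
    exact (hlim t ht).const_mul _
  have hF : Integrable (fun t => sieveKernel κ t * Φ (t - 1)) (volume.restrict (Ioi s)) := by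
    refine Integrable.mono' hg hmeas ?_
    refine (ae_restrict_mem measurableSet_Ioi).mono fun t (ht : s < t) => ?_
    rw [Real.norm_eq_abs]
    exact hdom t ht
  refine integral_tendsto_of_tendsto_of_monotone hint hF ?_ ?_
  · refine (ae_restrict_mem measurableSet_Ioi).mono fun t (ht : s < t) => ?_
    intro N M hNM
    exact mul_le_mul_of_nonneg_left (hmono t ht hNM) (sieveKernel_nonneg hκ (by linarith))
  · refine (ae_restrict_mem measurableSet_Ioi).mono fun t (ht : s < t) => ?_
    exact (hlim t ht).const_mul _

/-! ### The limits `T^±` in dimension `1/2` and the equations (7.7) at `β = 1` -/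

section HalfLimits

variable {c : ℝ}
  (hbdM : ∀ (N : ℕ) (u : ℝ), 1 ≤ u → contT 0 (1 / 2) 1 N u ≤ c * qLower 1 2 u)
  (hbdP : ∀ (N : ℕ) (u : ℝ), 0 ≤ u → contT 1 (1 / 2) 1 N u ≤ c * qUpper 1 2 u)
include hbdM hbdP

omit hbdM in
/-- The dominating function `c k(t) Z⁺(t − 1)` is integrable on `(s, ∞)` for `s ≥ 1`
(`∫_s^U k Z⁺(· − 1) ≤ 1` uniformly, `integral_half_zUpper_le_one_of_le`). [folklore] -/
theorem integrableOn_half_majorant_zUpper {s : ℝ} (hs : 1 ≤ s) :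
    IntegrableOn (fun t => c * (sieveKernel (1 / 2) t * qUpper 1 2 (t - 1))) (Ioi s) volume := by
  have hc : 0 ≤ c := by
    have h := hbdP 0 0 le_rfl
    rw [contT_zero_right, zUpper_eq (by norm_num)] at h
    linarith
  refine integrableOn_Ioi_of_intervalIntegral_norm_bounded (c * 1) s
    (b := fun n : ℕ => s + n) (l := atTop) (fun n => ?_) ?_ ?_
  · exact ((intervalIntegrable_half continuous_zUpper hs (by simp : s ≤ s + n)).const_mul c).1
  · exact tendsto_atTop_add_const_left _ _ tendsto_natCast_atTop_atTop
  · refine Eventually.of_forall fun n => ?_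
    have hsn : s ≤ s + n := by simp
    have hnn : ∀ t ∈ Ioc s (s + n), 0 ≤ c * (sieveKernel (1 / 2) t * qUpper 1 2 (t - 1)) :=
      fun t ht => mul_nonneg hc (mul_nonneg (sieveKernel_nonneg (by norm_num) (by linarith [ht.1]))
        (zUpper_pos _).le)
    calc ∫ t in s..(s + n), ‖c * (sieveKernel (1 / 2) t * qUpper 1 2 (t - 1))‖
        = ∫ t in s..(s + n), c * (sieveKernel (1 / 2) t * qUpper 1 2 (t - 1)) := by
          rw [intervalIntegral.integral_of_le hsn, intervalIntegral.integral_of_le hsn]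
          refine setIntegral_congr_fun measurableSet_Ioc fun t ht => ?_
          exact Real.norm_of_nonneg (hnn t ht)
      _ = c * ∫ t in s..(s + n), sieveKernel (1 / 2) t * qUpper 1 2 (t - 1) := by
          rw [intervalIntegral.integral_const_mul]
      _ ≤ c * 1 := mul_le_mul_of_nonneg_left (integral_half_zUpper_le_one_of_le hs hsn) hc

omit hbdM in
/-- The dominating function `c k(t) Z⁻(t − 1)` is integrable on `(s, ∞)` for `s ≥ 2`
(`∫_s^U k Z⁻(· − 1) ≤ 1/2` uniformly, `integral_half_zLower_le_half_of_le`). [folklore] -/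
theorem integrableOn_half_majorant_zLower {s : ℝ} (hs : 2 ≤ s) :
    IntegrableOn (fun t => c * (sieveKernel (1 / 2) t * qLower 1 2 (t - 1))) (Ioi s) volume := by
  have hc : 0 ≤ c := by
    have h := hbdP 0 0 le_rfl
    rw [contT_zero_right, zUpper_eq (by norm_num)] at h
    linarith
  have hs1 : 1 ≤ s := by linarith
  refine integrableOn_Ioi_of_intervalIntegral_norm_bounded (c * (1 / 2)) s
    (b := fun n : ℕ => s + n) (l := atTop) (fun n => ?_) ?_ ?_
  · exact ((intervalIntegrable_half continuous_zLower hs1 (by simp : s ≤ s + n)).const_mul c).1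
  · exact tendsto_atTop_add_const_left _ _ tendsto_natCast_atTop_atTop
  · refine Eventually.of_forall fun n => ?_
    have hsn : s ≤ s + n := by simp
    have hnn : ∀ t ∈ Ioc s (s + n), 0 ≤ c * (sieveKernel (1 / 2) t * qLower 1 2 (t - 1)) :=
      fun t ht => mul_nonneg hc (mul_nonneg (sieveKernel_nonneg (by norm_num) (by linarith [ht.1]))
        (zLower_pos _).le)
    calc ∫ t in s..(s + n), ‖c * (sieveKernel (1 / 2) t * qLower 1 2 (t - 1))‖
        = ∫ t in s..(s + n), c * (sieveKernel (1 / 2) t * qLower 1 2 (t - 1)) := by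
          rw [intervalIntegral.integral_of_le hsn, intervalIntegral.integral_of_le hsn]
          refine setIntegral_congr_fun measurableSet_Ioc fun t ht => ?_
          exact Real.norm_of_nonneg (hnn t ht)
      _ = c * ∫ t in s..(s + n), sieveKernel (1 / 2) t * qLower 1 2 (t - 1) := by
          rw [intervalIntegral.integral_const_mul]
      _ ≤ c * (1 / 2) := mul_le_mul_of_nonneg_left (integral_half_zLower_le_half_of_le hs hsn) hc

omit hbdM hbdP in
/-- `T⁺_N(u) ≤ c Z⁺(u)` for `u ≥ 0` gives `T⁺(u) ≤ c Z⁺(u)`. [folklore] -/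
theorem contTLim_one_half_le (hbdP : ∀ (N : ℕ) (u : ℝ), 0 ≤ u → contT 1 (1 / 2) 1 N u ≤ c * qUpper 1 2 u)
    {u : ℝ} (hu : 0 ≤ u) : contTLim 1 (1 / 2) 1 u ≤ c * qUpper 1 2 u :=
  contTLim_le 1 fun N => hbdP N u hu

omit hbdM hbdP in
/-- `T⁻(u) ≤ c Z⁻(u)` for `u ≥ 1`. [folklore] -/
theorem contTLim_zero_half_le (hbdM : ∀ (N : ℕ) (u : ℝ), 1 ≤ u → contT 0 (1 / 2) 1 N u ≤ c * qLower 1 2 u)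
    {u : ℝ} (hu : 1 ≤ u) : contTLim 0 (1 / 2) 1 u ≤ c * qLower 1 2 u :=
  contTLim_le 0 fun N => hbdM N u hu

omit hbdM hbdP in
/-- `0 ≤ T⁺(u)` for `u ≥ 0`. [folklore] -/
theorem contTLim_one_half_nonneg (hbdP : ∀ (N : ℕ) (u : ℝ), 0 ≤ u → contT 1 (1 / 2) 1 N u ≤ c * qUpper 1 2 u)
    {u : ℝ} (hu : 0 ≤ u) : 0 ≤ contTLim 1 (1 / 2) 1 u :=
  contTLim_nonneg (by norm_num) le_rfl 1 hu fun N => hbdP N u hu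

omit hbdM hbdP in
/-- `0 ≤ T⁻(u)` for `u ≥ 1`. [folklore] -/
theorem contTLim_zero_half_nonneg (hbdM : ∀ (N : ℕ) (u : ℝ), 1 ≤ u → contT 0 (1 / 2) 1 N u ≤ c * qLower 1 2 u)
    {u : ℝ} (hu : 1 ≤ u) : 0 ≤ contTLim 0 (1 / 2) 1 u :=
  contTLim_nonneg (by norm_num) le_rfl 0 (by linarith) fun N => hbdM N u hu

/-- **(7.7) for `T⁻` in dimension `1/2`**: `T⁻(s) = ∫_s^∞ k(t) T⁺(t − 1) dt` for every `s ≥ 1`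
(at `s = β = 1` the lower limit is the singularity of the kernel), by monotone convergence from
(7.3) at `β = 1` with the dominating function `c k(t) Z⁺(t − 1)`.
[cite: IwaniecActaArith1980, Lemma 18 (7.7)] -/
theorem contTLim_zero_half_eq_setIntegral {s : ℝ} (hs : 1 ≤ s) :
    contTLim 0 (1 / 2) 1 s = ∫ t in Ioi s, sieveKernel (1 / 2) t * contTLim 1 (1 / 2) 1 (t - 1) := by
  have hc : 0 ≤ c := by
    have h := hbdP 0 0 le_rfl
    rw [contT_zero_right, zUpper_eq (by norm_num)] at h
    linarith
  have hκ0 : (0:ℝ) ≤ 1 / 2 := by norm_num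
  have hκ1 : (1 / 2 : ℝ) < 1 := by norm_num
  have happrox : ∀ N : ℕ,
      ∫ t in Ioi s, sieveKernel (1 / 2) t * contT 1 (1 / 2) 1 N (t - 1) = contT 0 (1 / 2) 1 (N + 1) s := by
    intro N
    have hsU : s ≤ max s (1 + N + 1) := le_max_left _ _
    rw [contT_zero_succ_eq_integral_one hκ0 hκ1 N hs le_rfl]
    refine setIntegral_Ioi_eq_intervalIntegral_of_integrableOn hsU
      (intervalIntegrable_sieveKernel_mul_of_one_le hκ1 (continuous_contT_one hκ0 hκ1 1 N) hs hsU).1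
      fun t ht => ?_
    rw [contT_eq_zero_of_le 1 (1 / 2) (by linarith [le_max_right s (1 + (N : ℝ) + 1)]), mul_zero]
  have hmct := tendsto_setIntegral_sieveKernel_mul_of_one_le hκ0 hκ1 hs
    (φ := fun N => contT 1 (1 / 2) 1 N) (Φ := contTLim 1 (1 / 2) 1)
    (fun N => continuous_contT_one hκ0 hκ1 1 N) (fun N t ht => contT_eq_zero_of_le 1 (1 / 2) ht)
    (fun t ht => contT_mono_right hκ0 le_rfl 1 (by linarith))
    (fun t ht => tendsto_contT_contTLim hκ0 le_rfl 1 (by linarith) (fun N => hbdP N (t - 1) (by linarith)))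
    (integrableOn_half_majorant_zUpper hbdP hs) (fun t ht => ?_)
  · simp_rw [happrox] at hmct
    have hlim2 : Tendsto (fun N => contT 0 (1 / 2) 1 (N + 1) s) atTop (𝓝 (contTLim 0 (1 / 2) 1 s)) :=
      (tendsto_contT_contTLim hκ0 le_rfl 0 (by linarith) (fun N => hbdM N s hs)).comp
        (tendsto_add_atTop_nat 1)
    exact tendsto_nhds_unique hlim2 hmct
  · have hΦ0 : 0 ≤ contTLim 1 (1 / 2) 1 (t - 1) := contTLim_one_half_nonneg hbdP (by linarith)
    have hΦle : contTLim 1 (1 / 2) 1 (t - 1) ≤ c * qUpper 1 2 (t - 1) :=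
      contTLim_one_half_le hbdP (by linarith)
    have hk0 : 0 ≤ sieveKernel (1 / 2) t := sieveKernel_nonneg hκ0 (by linarith)
    rw [abs_of_nonneg (mul_nonneg hk0 hΦ0)]
    calc sieveKernel (1 / 2) t * contTLim 1 (1 / 2) 1 (t - 1)
        ≤ sieveKernel (1 / 2) t * (c * qUpper 1 2 (t - 1)) := mul_le_mul_of_nonneg_left hΦle hk0
      _ = c * (sieveKernel (1 / 2) t * qUpper 1 2 (t - 1)) := by ring

/-- **(7.7) for `T⁺` in dimension `1/2`**: `T⁺(s) = ∫_s^∞ k(t) T⁻(t − 1) dt` for `s ≥ 2 = β + 1`.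
[cite: IwaniecActaArith1980, Lemma 18 (7.7)] -/
theorem contTLim_one_half_eq_setIntegral {s : ℝ} (hs : 2 ≤ s) :
    contTLim 1 (1 / 2) 1 s = ∫ t in Ioi s, sieveKernel (1 / 2) t * contTLim 0 (1 / 2) 1 (t - 1) := by
  have hc : 0 ≤ c := by
    have h := hbdP 0 0 le_rfl
    rw [contT_zero_right, zUpper_eq (by norm_num)] at h
    linarith
  have hκ0 : (0:ℝ) ≤ 1 / 2 := by norm_num
  have hκ1 : (1 / 2 : ℝ) < 1 := by norm_num
  have hs1 : 1 < s := by linarith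
  have happrox : ∀ N : ℕ,
      ∫ t in Ioi s, sieveKernel (1 / 2) t * contT 0 (1 / 2) 1 N (t - 1) = contT 1 (1 / 2) 1 (N + 1) s := by
    intro N
    have hsU : s ≤ max s (1 + N + 1) := le_max_left _ _
    rw [contT_one_succ_eq_integral_one hκ0 hκ1 N hs le_rfl]
    refine setIntegral_Ioi_eq_intervalIntegral_of_integrableOn hsU
      (intervalIntegrable_sieveKernel_mul_of_one_le hκ1 (continuous_contT_one hκ0 hκ1 0 N) hs1.le hsU).1
      fun t ht => ?_
    rw [contT_eq_zero_of_le 0 (1 / 2) (by linarith [le_max_right s (1 + (N : ℝ) + 1)]), mul_zero]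
  have hmct := tendsto_setIntegral_sieveKernel_mul hκ0 (β := 1) hs1
    (φ := fun N => contT 0 (1 / 2) 1 N) (Φ := contTLim 0 (1 / 2) 1)
    (fun N => continuous_contT_one hκ0 hκ1 0 N) (fun N t ht => contT_eq_zero_of_le 0 (1 / 2) ht)
    (fun t ht => contT_mono_right hκ0 le_rfl 0 (by linarith))
    (fun t ht => tendsto_contT_contTLim hκ0 le_rfl 0 (by linarith) (fun N => hbdM N (t - 1) (by linarith)))
    (integrableOn_half_majorant_zLower hbdP hs) (fun t ht => ?_)
  · simp_rw [happrox] at hmct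
    have hlim2 : Tendsto (fun N => contT 1 (1 / 2) 1 (N + 1) s) atTop (𝓝 (contTLim 1 (1 / 2) 1 s)) :=
      (tendsto_contT_contTLim hκ0 le_rfl 1 (by linarith) (fun N => hbdP N s (by linarith))).comp
        (tendsto_add_atTop_nat 1)
    exact tendsto_nhds_unique hlim2 hmct
  · have hΦ0 : 0 ≤ contTLim 0 (1 / 2) 1 (t - 1) := contTLim_zero_half_nonneg hbdM (by linarith)
    have hΦle : contTLim 0 (1 / 2) 1 (t - 1) ≤ c * qLower 1 2 (t - 1) :=
      contTLim_zero_half_le hbdM (by linarith)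
    have hk0 : 0 ≤ sieveKernel (1 / 2) t := sieveKernel_nonneg hκ0 (by linarith)
    rw [abs_of_nonneg (mul_nonneg hk0 hΦ0)]
    calc sieveKernel (1 / 2) t * contTLim 0 (1 / 2) 1 (t - 1)
        ≤ sieveKernel (1 / 2) t * (c * qLower 1 2 (t - 1)) := mul_le_mul_of_nonneg_left hΦle hk0
      _ = c * (sieveKernel (1 / 2) t * qLower 1 2 (t - 1)) := by ring

omit hbdM in
/-- **(7.7), the `+` boundary relation, at `β = 1`**: `T⁺(s) + s^{1/2} = 2^{1/2} + T⁺(2)` for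
`0 < s ≤ 2` (limit of the third line of (7.3)). [cite: IwaniecActaArith1980, Lemma 18 (7.7)] -/
theorem contTLim_one_half_eq_of_le {s : ℝ} (hs0 : 0 < s) (hs : s ≤ 1 + 1) :
    contTLim 1 (1 / 2) 1 s =
      (1 + 1 : ℝ) ^ (1 / 2 : ℝ) - s ^ (1 / 2 : ℝ) + contTLim 1 (1 / 2) 1 (1 + 1) := by
  have hc : 0 ≤ c := by
    have h := hbdP 0 0 le_rfl
    rw [contT_zero_right, zUpper_eq (by norm_num)] at h
    linarith
  have hκ0 : (0:ℝ) ≤ 1 / 2 := by norm_num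
  have hbdb : ∀ N, contT 1 (1 / 2) 1 N (1 + 1) ≤ c * qUpper 1 2 (1 + 1) := fun N => hbdP N _ (by norm_num)
  have hbds : ∀ N, contT 1 (1 / 2) 1 N s ≤ (1 + 1 : ℝ) ^ (1 / 2 : ℝ) + c * qUpper 1 2 (1 + 1) := by
    intro N
    rcases Nat.eq_zero_or_pos N with h0 | hN
    · subst h0
      rw [contT_zero_right]
      exact add_nonneg (Real.rpow_nonneg (by norm_num) _)
        ((contT_nonneg hκ0 le_rfl 1 0 (by norm_num : (0:ℝ) ≤ 1 + 1)).trans (hbdb 0))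
    · rw [contT_one_eq_of_le hN hs]
      have := hbdb N
      have : 0 ≤ s ^ (1 / 2 : ℝ) := Real.rpow_nonneg hs0.le _
      linarith
  have h1 := tendsto_contT_contTLim hκ0 le_rfl 1 hs0.le hbds
  have h2 : Tendsto (fun N => (1 + 1 : ℝ) ^ (1 / 2 : ℝ) - s ^ (1 / 2 : ℝ) + contT 1 (1 / 2) 1 N (1 + 1)) atTop
      (𝓝 ((1 + 1 : ℝ) ^ (1 / 2 : ℝ) - s ^ (1 / 2 : ℝ) + contTLim 1 (1 / 2) 1 (1 + 1))) :=
    (tendsto_contT_contTLim hκ0 le_rfl 1 (by norm_num) hbdb).const_add _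
  have heq : (fun N => contT 1 (1 / 2) 1 N s) =ᶠ[atTop]
      fun N => (1 + 1 : ℝ) ^ (1 / 2 : ℝ) - s ^ (1 / 2 : ℝ) + contT 1 (1 / 2) 1 N (1 + 1) := by
    filter_upwards [eventually_ge_atTop 1] with N hN
    exact contT_one_eq_of_le hN hs
  exact tendsto_nhds_unique (h1.congr' heq) h2

end HalfLimits

/-! ### Integrability of the limit integrands, continuity and differentiability of `T^±` -/

section HalfRegularity

variable {c : ℝ}
  (hbdM : ∀ (N : ℕ) (u : ℝ), 1 ≤ u → contT 0 (1 / 2) 1 N u ≤ c * qLower 1 2 u)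
  (hbdP : ∀ (N : ℕ) (u : ℝ), 0 ≤ u → contT 1 (1 / 2) 1 N u ≤ c * qUpper 1 2 u)
include hbdM hbdP

omit hbdM in
/-- The integrand `k(t) T⁺(t − 1)` of `T⁻` is integrable on `(s, ∞)` for `s ≥ 1` (dominated by
`c k(t) Z⁺(t − 1)`; measurable as a pointwise limit). [folklore] -/
theorem integrableOn_half_kernel_contTLim_one {s : ℝ} (hs : 1 ≤ s) :
    IntegrableOn (fun t => sieveKernel (1 / 2) t * contTLim 1 (1 / 2) 1 (t - 1)) (Ioi s) volume := by
  have hc : 0 ≤ c := by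
    have h := hbdP 0 0 le_rfl
    rw [contT_zero_right, zUpper_eq (by norm_num)] at h
    linarith
  have hκ0 : (0:ℝ) ≤ 1 / 2 := by norm_num
  have hκ1 : (1 / 2 : ℝ) < 1 := by norm_num
  have hmeas : AEStronglyMeasurable (fun t => sieveKernel (1 / 2) t * contTLim 1 (1 / 2) 1 (t - 1))
      (volume.restrict (Ioi s)) := by
    refine aestronglyMeasurable_of_tendsto_ae atTop
      (f := fun N t => sieveKernel (1 / 2) t * contT 1 (1 / 2) 1 N (t - 1)) (fun N => ?_) ?_
    · have hsU : s ≤ max s (1 + N + 1) := le_max_left _ _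
      have hI := (intervalIntegrable_sieveKernel_mul_of_one_le hκ1 (continuous_contT_one hκ0 hκ1 1 N)
        hs hsU).1
      exact (integrableOn_Ioi_of_integrableOn_of_support hsU hI fun t ht => by
        rw [contT_eq_zero_of_le 1 (1 / 2) (by linarith [le_max_right s (1 + (N : ℝ) + 1)]),
          mul_zero]).aestronglyMeasurable
    · refine (ae_restrict_mem measurableSet_Ioi).mono fun t (ht : s < t) => ?_
      exact (tendsto_contT_contTLim hκ0 le_rfl 1 (by linarith)
        (fun N => hbdP N (t - 1) (by linarith))).const_mul _
  refine Integrable.mono' (integrableOn_half_majorant_zUpper hbdP hs) hmeas ?_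
  refine (ae_restrict_mem measurableSet_Ioi).mono fun t (ht : s < t) => ?_
  have hΦ0 : 0 ≤ contTLim 1 (1 / 2) 1 (t - 1) := contTLim_one_half_nonneg hbdP (by linarith)
  have hΦle : contTLim 1 (1 / 2) 1 (t - 1) ≤ c * qUpper 1 2 (t - 1) :=
    contTLim_one_half_le hbdP (by linarith)
  have hk0 : 0 ≤ sieveKernel (1 / 2) t := sieveKernel_nonneg hκ0 (by linarith)
  rw [Real.norm_eq_abs, abs_of_nonneg (mul_nonneg hk0 hΦ0)]
  calc sieveKernel (1 / 2) t * contTLim 1 (1 / 2) 1 (t - 1)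
      ≤ sieveKernel (1 / 2) t * (c * qUpper 1 2 (t - 1)) := mul_le_mul_of_nonneg_left hΦle hk0
    _ = c * (sieveKernel (1 / 2) t * qUpper 1 2 (t - 1)) := by ring

/-- The integrand `k(t) T⁻(t − 1)` of `T⁺` is integrable on `(s, ∞)` for `s ≥ 2`. [folklore] -/
theorem integrableOn_half_kernel_contTLim_zero {s : ℝ} (hs : 2 ≤ s) :
    IntegrableOn (fun t => sieveKernel (1 / 2) t * contTLim 0 (1 / 2) 1 (t - 1)) (Ioi s) volume := by
  have hc : 0 ≤ c := by
    have h := hbdP 0 0 le_rfl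
    rw [contT_zero_right, zUpper_eq (by norm_num)] at h
    linarith
  have hκ0 : (0:ℝ) ≤ 1 / 2 := by norm_num
  have hκ1 : (1 / 2 : ℝ) < 1 := by norm_num
  have hs1 : 1 ≤ s := by linarith
  have hmeas : AEStronglyMeasurable (fun t => sieveKernel (1 / 2) t * contTLim 0 (1 / 2) 1 (t - 1))
      (volume.restrict (Ioi s)) := by
    refine aestronglyMeasurable_of_tendsto_ae atTop
      (f := fun N t => sieveKernel (1 / 2) t * contT 0 (1 / 2) 1 N (t - 1)) (fun N => ?_) ?_
    · have hsU : s ≤ max s (1 + N + 1) := le_max_left _ _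
      have hI := (intervalIntegrable_sieveKernel_mul_of_one_le hκ1 (continuous_contT_one hκ0 hκ1 0 N)
        hs1 hsU).1
      exact (integrableOn_Ioi_of_integrableOn_of_support hsU hI fun t ht => by
        rw [contT_eq_zero_of_le 0 (1 / 2) (by linarith [le_max_right s (1 + (N : ℝ) + 1)]),
          mul_zero]).aestronglyMeasurable
    · refine (ae_restrict_mem measurableSet_Ioi).mono fun t (ht : s < t) => ?_
      exact (tendsto_contT_contTLim hκ0 le_rfl 0 (by linarith)
        (fun N => hbdM N (t - 1) (by linarith))).const_mul _
  refine Integrable.mono' (integrableOn_half_majorant_zLower hbdP hs) hmeas ?_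
  refine (ae_restrict_mem measurableSet_Ioi).mono fun t (ht : s < t) => ?_
  have hΦ0 : 0 ≤ contTLim 0 (1 / 2) 1 (t - 1) := contTLim_zero_half_nonneg hbdM (by linarith)
  have hΦle : contTLim 0 (1 / 2) 1 (t - 1) ≤ c * qLower 1 2 (t - 1) :=
    contTLim_zero_half_le hbdM (by linarith)
  have hk0 : 0 ≤ sieveKernel (1 / 2) t := sieveKernel_nonneg hκ0 (by linarith)
  rw [Real.norm_eq_abs, abs_of_nonneg (mul_nonneg hk0 hΦ0)]
  calc sieveKernel (1 / 2) t * contTLim 0 (1 / 2) 1 (t - 1)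
      ≤ sieveKernel (1 / 2) t * (c * qLower 1 2 (t - 1)) := mul_le_mul_of_nonneg_left hΦle hk0
    _ = c * (sieveKernel (1 / 2) t * qLower 1 2 (t - 1)) := by ring

/-- `T⁻` as a primitive from the sieving threshold: `T⁻(s) = T⁻(1) − ∫_1^s k(t) T⁺(t − 1) dt` for
`s ≥ 1`. [folklore] -/
theorem contTLim_zero_half_eq_sub_integral {s : ℝ} (hs : 1 ≤ s) :
    contTLim 0 (1 / 2) 1 s = contTLim 0 (1 / 2) 1 1 -
      ∫ t in (1:ℝ)..s, sieveKernel (1 / 2) t * contTLim 1 (1 / 2) 1 (t - 1) := by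
  rw [contTLim_zero_half_eq_setIntegral hbdM hbdP hs,
    contTLim_zero_half_eq_setIntegral hbdM hbdP le_rfl,
    ← intervalIntegral.integral_Ioi_sub_Ioi (integrableOn_half_kernel_contTLim_one hbdP le_rfl) hs]
  ring

/-- `T⁺` as a primitive: `T⁺(s) = T⁺(2) − ∫_2^s k(t) T⁻(t − 1) dt` for `s ≥ 2`. [folklore] -/
theorem contTLim_one_half_eq_sub_integral {s : ℝ} (hs : 2 ≤ s) :
    contTLim 1 (1 / 2) 1 s = contTLim 1 (1 / 2) 1 2 -
      ∫ t in (2:ℝ)..s, sieveKernel (1 / 2) t * contTLim 0 (1 / 2) 1 (t - 1) := by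
  rw [contTLim_one_half_eq_setIntegral hbdM hbdP hs,
    contTLim_one_half_eq_setIntegral hbdM hbdP le_rfl,
    ← intervalIntegral.integral_Ioi_sub_Ioi (integrableOn_half_kernel_contTLim_zero hbdM hbdP le_rfl) hs]
  ring

omit hbdM in
/-- A closed form for `T⁺` on `(0, 2]` with the constant written at `2`. [folklore] -/
theorem contTLim_one_half_eq_of_le_two {s : ℝ} (hs0 : 0 < s) (hs : s ≤ 2) :
    contTLim 1 (1 / 2) 1 s = (2 : ℝ) ^ (1 / 2 : ℝ) - s ^ (1 / 2 : ℝ) + contTLim 1 (1 / 2) 1 2 := by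
  have h := contTLim_one_half_eq_of_le hbdP hs0 (by norm_num; exact hs)
  norm_num at h
  exact h

/-- **`T⁺` is continuous on `(0, ∞)`** in dimension `1/2`: on `(0, 2]` by the closed form, on
`[2, ∞)` as a primitive of an integrable function; the single formula
`T⁺(s) = T⁺(2) + (2^{1/2} − min(s, 2)^{1/2}) − ∫_2^{max(s,2)} k T⁻(· − 1)` covers both.
[cite: IwaniecActaArith1980, Lemma 18] -/
theorem continuousOn_contTLim_one_half : ContinuousOn (contTLim 1 (1 / 2) 1) (Ioi 0) := by
  set Ψ : ℝ → ℝ := fun u => ∫ t in (2:ℝ)..u, sieveKernel (1 / 2) t * contTLim 0 (1 / 2) 1 (t - 1)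
    with hΨ
  have hΨc : ContinuousOn Ψ (Ici 2) := by
    intro u hu
    have hu2 : (2:ℝ) ≤ u := hu
    have hint : IntegrableOn (fun t => sieveKernel (1 / 2) t * contTLim 0 (1 / 2) 1 (t - 1))
        (uIcc 2 (u + 1)) volume := by
      rw [uIcc_of_le (by linarith)]
      exact (integrableOn_Icc_iff_integrableOn_Ioc).mpr
        ((integrableOn_half_kernel_contTLim_zero hbdM hbdP le_rfl).mono_set Ioc_subset_Ioi_self)
    have hc := intervalIntegral.continuousOn_primitive_interval hint
    rw [uIcc_of_le (by linarith)] at hc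
    exact (hc.continuousWithinAt ⟨hu2, by linarith⟩).mono_of_mem_nhdsWithin
      (Filter.mem_of_superset (inter_mem self_mem_nhdsWithin
        (mem_nhdsWithin_of_mem_nhds (Iic_mem_nhds (by linarith : u < u + 1))))
        fun x hx => ⟨hx.1, hx.2⟩)
  have hform : ∀ s, 0 < s → contTLim 1 (1 / 2) 1 s =
      contTLim 1 (1 / 2) 1 2 + ((2:ℝ) ^ (1 / 2 : ℝ) - (min s 2) ^ (1 / 2 : ℝ)) - Ψ (max s 2) := by
    intro s hs0
    rcases le_or_gt s 2 with h2 | h2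
    · rw [min_eq_left h2, max_eq_right h2, hΨ]
      simp only [intervalIntegral.integral_same, sub_zero]
      rw [contTLim_one_half_eq_of_le_two hbdP hs0 h2]; ring
    · rw [min_eq_right h2.le, max_eq_left h2.le, contTLim_one_half_eq_sub_integral hbdM hbdP h2.le]
      ring
  have hc2 : ContinuousOn (fun s : ℝ =>
      contTLim 1 (1 / 2) 1 2 + ((2:ℝ) ^ (1 / 2 : ℝ) - (min s 2) ^ (1 / 2 : ℝ)) - Ψ (max s 2)) (Ioi 0) := by
    refine (continuousOn_const.add (continuousOn_const.sub ?_)).sub ?_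
    · exact (continuous_id.min continuous_const).continuousOn.rpow_const fun x hx =>
        Or.inl (ne_of_gt (lt_min hx (by norm_num)))
    · exact hΨc.comp (continuous_id.max continuous_const).continuousOn fun x _ =>
        show (2:ℝ) ≤ max (id x) 2 from le_max_right _ _
  exact hc2.congr fun s hs => hform s hs

/-- **`T⁻` is continuous on `[1, ∞)`** in dimension `1/2` (a primitive of an integrable function
from the sieving threshold). [cite: IwaniecActaArith1980, Lemma 18] -/
theorem continuousOn_contTLim_zero_half : ContinuousOn (contTLim 0 (1 / 2) 1) (Ici 1) := by
  intro u hu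
  have hu1 : (1:ℝ) ≤ u := hu
  have hint : IntegrableOn (fun t => sieveKernel (1 / 2) t * contTLim 1 (1 / 2) 1 (t - 1))
      (uIcc 1 (u + 1)) volume := by
    rw [uIcc_of_le (by linarith)]
    exact (integrableOn_Icc_iff_integrableOn_Ioc).mpr
      ((integrableOn_half_kernel_contTLim_one hbdP le_rfl).mono_set Ioc_subset_Ioi_self)
  have hc := intervalIntegral.continuousOn_primitive_interval hint
  rw [uIcc_of_le (by linarith)] at hc
  have hc2 : ContinuousOn (fun x => contTLim 0 (1 / 2) 1 1 -
      ∫ t in (1:ℝ)..x, sieveKernel (1 / 2) t * contTLim 1 (1 / 2) 1 (t - 1)) (Icc 1 (u + 1)) :=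
    continuousOn_const.sub hc
  have hc3 : ContinuousOn (contTLim 0 (1 / 2) 1) (Icc 1 (u + 1)) :=
    hc2.congr fun s hs => contTLim_zero_half_eq_sub_integral hbdM hbdP hs.1
  exact (hc3.continuousWithinAt ⟨hu1, by linarith⟩).mono_of_mem_nhdsWithin
    (Filter.mem_of_superset (inter_mem self_mem_nhdsWithin
      (mem_nhdsWithin_of_mem_nhds (Iic_mem_nhds (by linarith : u < u + 1))))
      fun x hx => ⟨hx.1, hx.2⟩)

/-- **`(T⁻)'(s) = −k(s) T⁺(s − 1)`** for `s > 1` in dimension `1/2`.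
[cite: IwaniecActaArith1980, Lemma 18 (7.7)] -/
theorem hasDerivAt_contTLim_zero_half {s : ℝ} (hs : 1 < s) :
    HasDerivAt (contTLim 0 (1 / 2) 1) (-(sieveKernel (1 / 2) s * contTLim 1 (1 / 2) 1 (s - 1))) s := by
  have hg : ContinuousOn (fun t => sieveKernel (1 / 2) t * contTLim 1 (1 / 2) 1 (t - 1)) (Ioi 1) :=
    continuousOn_sieveKernel_mul_comp (continuousOn_contTLim_one_half hbdM hbdP)
  have hint : IntervalIntegrable (fun t => sieveKernel (1 / 2) t * contTLim 1 (1 / 2) 1 (t - 1))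
      volume 1 s :=
    (intervalIntegrable_iff_integrableOn_Ioc_of_le hs.le).mpr
      ((integrableOn_half_kernel_contTLim_one hbdP le_rfl).mono_set Ioc_subset_Ioi_self)
  have hP := intervalIntegral.integral_hasDerivAt_right hint
    (hg.stronglyMeasurableAtFilter isOpen_Ioi s hs) (hg.continuousAt (Ioi_mem_nhds hs))
  refine (hP.const_sub (contTLim 0 (1 / 2) 1 1)).congr_of_eventuallyEq ?_
  filter_upwards [Ioi_mem_nhds hs] with u hu
  exact contTLim_zero_half_eq_sub_integral hbdM hbdP hu.le

/-- **`(T⁺)'(s) = −k(s) T⁻(s − 1)`** for `s > 2` in dimension `1/2`.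
[cite: IwaniecActaArith1980, Lemma 18 (7.7)] -/
theorem hasDerivAt_contTLim_one_half {s : ℝ} (hs : 2 < s) :
    HasDerivAt (contTLim 1 (1 / 2) 1) (-(sieveKernel (1 / 2) s * contTLim 0 (1 / 2) 1 (s - 1))) s := by
  have hg : ContinuousOn (fun t => sieveKernel (1 / 2) t * contTLim 0 (1 / 2) 1 (t - 1)) (Ioi 2) :=
    ((continuousOn_sieveKernel (1 / 2)).mono fun t (ht : (2:ℝ) < t) => show (1 : ℝ) < t by
      linarith).mul
      ((continuousOn_contTLim_zero_half hbdM hbdP).comp (continuousOn_id.sub continuousOn_const)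
        fun t (ht : (2:ℝ) < t) => show (1:ℝ) ≤ id t - 1 by simp only [id]; linarith)
  have hint : IntervalIntegrable (fun t => sieveKernel (1 / 2) t * contTLim 0 (1 / 2) 1 (t - 1))
      volume 2 s :=
    (intervalIntegrable_iff_integrableOn_Ioc_of_le hs.le).mpr
      ((integrableOn_half_kernel_contTLim_zero hbdM hbdP le_rfl).mono_set Ioc_subset_Ioi_self)
  have hP := intervalIntegral.integral_hasDerivAt_right hint
    (hg.stronglyMeasurableAtFilter isOpen_Ioi s hs) (hg.continuousAt (Ioi_mem_nhds hs))
  refine (hP.const_sub (contTLim 1 (1 / 2) 1 2)).congr_of_eventuallyEq ?_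
  filter_upwards [Ioi_mem_nhds hs] with u hu
  exact contTLim_one_half_eq_sub_integral hbdM hbdP hu.le

end HalfRegularity

/-! ### The candidate functions at `β = 1`: `F̃ = 1 + s^{−1/2} T⁺`, `f̃ = 1 − s^{−1/2} T⁻` -/

section HalfCandidate

variable {c : ℝ}
  (hbdM : ∀ (N : ℕ) (u : ℝ), 1 ≤ u → contT 0 (1 / 2) 1 N u ≤ c * qLower 1 2 u)
  (hbdP : ∀ (N : ℕ) (u : ℝ), 0 ≤ u → contT 1 (1 / 2) 1 N u ≤ c * qUpper 1 2 u)
include hbdM hbdP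

omit hbdM in
/-- `F̃(s) = Ã s^{−1/2}` on `(0, 2]` ((1.8) at `β = 1`). [cite: IwaniecActaArith1980, (1.8)] -/
theorem candUpper_half_eq {s : ℝ} (hs0 : 0 < s) (hs : s ≤ 1 + 1) :
    candUpper (1 / 2) 1 s = candConst (1 / 2) 1 * s ^ (-(1 / 2 : ℝ)) := by
  rw [candUpper, candConst, contTLim_one_half_eq_of_le hbdP hs0 hs]
  have e : s ^ (-(1 / 2 : ℝ)) * s ^ (1 / 2 : ℝ) = 1 := by
    rw [Real.rpow_neg hs0.le, inv_mul_cancel₀ (Real.rpow_pos_of_pos hs0 _).ne']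
  linear_combination (-1 : ℝ) * e

omit hbdM in
/-- `Ã > 0` at `β = 1`. [folklore] -/
theorem candConst_half_pos : 0 < candConst (1 / 2) 1 := by
  have h1 : 0 < (1 + 1 : ℝ) ^ (1 / 2 : ℝ) := Real.rpow_pos_of_pos (by norm_num) _
  have h2 : 0 ≤ contTLim 1 (1 / 2) 1 (1 + 1) := contTLim_one_half_nonneg hbdP (by norm_num)
  rw [candConst]; linarith

/-- **(1.9) for the candidates at `β = 1`**: `(s^{1/2} f̃(s))' = (1/2) s^{−1/2} F̃(s − 1)` for
`s > 1`. [cite: IwaniecActaArith1980, (1.8)–(1.9)] -/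
theorem hasDerivAt_candLower_half {s : ℝ} (hs : 1 < s) :
    HasDerivAt (fun t : ℝ => t ^ (1 / 2 : ℝ) * candLower (1 / 2) 1 t)
      ((1 / 2 : ℝ) * s ^ ((1 / 2 : ℝ) - 1) * candUpper (1 / 2) 1 (s - 1)) s := by
  have hs0 : 0 < s := by linarith
  have heq : (fun t : ℝ => t ^ (1 / 2 : ℝ) * candLower (1 / 2) 1 t) =ᶠ[𝓝 s]
      fun t => t ^ (1 / 2 : ℝ) - contTLim 0 (1 / 2) 1 t := by
    filter_upwards [Ioi_mem_nhds hs] with t (ht : 1 < t)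
    have ht0 : 0 < t := by linarith
    rw [candLower_eq_of_lt ht, mul_sub, mul_one, ← mul_assoc, ← Real.rpow_add ht0, add_neg_cancel,
      Real.rpow_zero, one_mul]
  have h1 : HasDerivAt (fun t : ℝ => t ^ (1 / 2 : ℝ)) ((1 / 2 : ℝ) * s ^ ((1 / 2 : ℝ) - 1)) s := by
    simpa using (hasDerivAt_id s).rpow_const (p := (1 / 2 : ℝ)) (Or.inl hs0.ne')
  have h2 := hasDerivAt_contTLim_zero_half hbdM hbdP hs
  refine ((h1.sub h2).congr_of_eventuallyEq heq).congr_deriv ?_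
  rw [candUpper, sieveKernel]
  ring

/-- **(1.8) for the candidates at `β = 1`**: `(s^{1/2} F̃(s))' = (1/2) s^{−1/2} f̃(s − 1)` for
`s > 2`. [cite: IwaniecActaArith1980, (1.8)–(1.9)] -/
theorem hasDerivAt_candUpper_half {s : ℝ} (hs : 1 + 1 < s) :
    HasDerivAt (fun t : ℝ => t ^ (1 / 2 : ℝ) * candUpper (1 / 2) 1 t)
      ((1 / 2 : ℝ) * s ^ ((1 / 2 : ℝ) - 1) * candLower (1 / 2) 1 (s - 1)) s := by
  have hs0 : 0 < s := by linarith
  have heq : (fun t : ℝ => t ^ (1 / 2 : ℝ) * candUpper (1 / 2) 1 t) =ᶠ[𝓝 s]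
      fun t => t ^ (1 / 2 : ℝ) + contTLim 1 (1 / 2) 1 t := by
    filter_upwards [Ioi_mem_nhds hs0] with t (ht0 : 0 < t)
    rw [candUpper, mul_add, mul_one, ← mul_assoc, ← Real.rpow_add ht0, add_neg_cancel, Real.rpow_zero,
      one_mul]
  have h1 : HasDerivAt (fun t : ℝ => t ^ (1 / 2 : ℝ)) ((1 / 2 : ℝ) * s ^ ((1 / 2 : ℝ) - 1)) s := by
    simpa using (hasDerivAt_id s).rpow_const (p := (1 / 2 : ℝ)) (Or.inl hs0.ne')
  have h2 := hasDerivAt_contTLim_one_half hbdM hbdP (by linarith : (2:ℝ) < s)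
  refine ((h1.add h2).congr_of_eventuallyEq heq).congr_deriv ?_
  rw [candLower_eq_of_lt (by linarith : (1:ℝ) < s - 1), sieveKernel]
  ring

/-- `F̃` is continuous on `(0, ∞)` (`β = 1`). [folklore] -/
theorem continuousOn_candUpper_half : ContinuousOn (candUpper (1 / 2) 1) (Ioi 0) :=
  continuousOn_const.add ((continuousOn_id.rpow_const fun _ hs => Or.inl (ne_of_gt hs)).mul
    (continuousOn_contTLim_one_half hbdM hbdP))

/-- `f̃` is continuous on `(0, ∞)` at `β = 1` (the two pieces agree at `1`: `B̃ = 1 − T⁻(1)`).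
[folklore] -/
theorem continuousOn_candLower_half : ContinuousOn (candLower (1 / 2) 1) (Ioi 0) := by
  have hleft : ContinuousOn (fun s : ℝ => candB (1 / 2) 1 * s ^ (-(1 / 2 : ℝ))) (Ioi 0) :=
    continuousOn_const.mul (continuousOn_id.rpow_const fun s hs => Or.inl (ne_of_gt hs))
  have hright : ContinuousOn (fun s : ℝ => 1 - s ^ (-(1 / 2 : ℝ)) * contTLim 0 (1 / 2) 1 s) (Ici 1) :=
    continuousOn_const.sub (((continuousOn_id.rpow_const fun s hs =>
      Or.inl (ne_of_gt (lt_of_lt_of_le one_pos hs)))).mul (continuousOn_contTLim_zero_half hbdM hbdP))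
  have hmatch : candB (1 / 2) 1 * (1:ℝ) ^ (-(1 / 2 : ℝ)) = 1 - (1:ℝ) ^ (-(1 / 2 : ℝ)) * contTLim 0 (1 / 2) 1 1 := by
    rw [candB, Real.one_rpow, Real.one_rpow]; ring
  intro x hx
  have hx0 : (0 : ℝ) < x := hx
  refine ContinuousAt.continuousWithinAt ?_
  rcases lt_trichotomy x 1 with hlt | heq | hgt
  · refine (hleft.continuousAt (Ioi_mem_nhds hx0)).congr_of_eventuallyEq ?_
    filter_upwards [Iio_mem_nhds hlt] with s hs using candLower_eq_of_le hs.le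
  · subst heq
    rw [continuousAt_iff_continuous_left_right]
    constructor
    · refine ((hleft.continuousAt (Ioi_mem_nhds hx0)).continuousWithinAt).congr_of_eventuallyEq
        ?_ (candLower_eq_of_le le_rfl)
      filter_upwards [self_mem_nhdsWithin] with s hs using candLower_eq_of_le hs
    · have hg : ContinuousWithinAt (fun s : ℝ => 1 - s ^ (-(1 / 2 : ℝ)) * contTLim 0 (1 / 2) 1 s)
          (Ici 1) 1 := hright 1 self_mem_Ici
      refine hg.congr_of_eventuallyEq ?_ ?_
      · filter_upwards [self_mem_nhdsWithin] with s hs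
        rcases eq_or_lt_of_le (show (1:ℝ) ≤ s from hs) with h | h
        · rw [← h, candLower_eq_of_le le_rfl, hmatch]
        · exact candLower_eq_of_lt h
      · rw [candLower_eq_of_le le_rfl, hmatch]
  · have hg : ContinuousAt (fun s : ℝ => 1 - s ^ (-(1 / 2 : ℝ)) * contTLim 0 (1 / 2) 1 s) x :=
      (hright.mono Ioi_subset_Ici_self).continuousAt (Ioi_mem_nhds hgt)
    refine hg.congr_of_eventuallyEq ?_
    filter_upwards [Ioi_mem_nhds hgt] with s hs using candLower_eq_of_lt hs

/-- `Q̃ = F̃ − f̃` is continuous on `(0, ∞)` (`β = 1`). [folklore] -/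
theorem continuousOn_candDiff_half : ContinuousOn (candDiff (1 / 2) 1) (Ioi 0) :=
  (continuousOn_candUpper_half hbdM hbdP).sub (continuousOn_candLower_half hbdM hbdP)

omit hbdM in
/-- `Q̃(x) = (Ã − B̃) x^{−1/2}` on `(0, 1]`. [cite: IwaniecActaArith1980, §7 (7.8)–(7.9)] -/
theorem candDiff_half_eq_of_le {x : ℝ} (hx0 : 0 < x) (hx : x ≤ 1) :
    candDiff (1 / 2) 1 x = (candConst (1 / 2) 1 - candB (1 / 2) 1) * x ^ (-(1 / 2 : ℝ)) := by
  rw [candDiff, candUpper_half_eq hbdP hx0 (by linarith), candLower_eq_of_le hx]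
  ring

omit hbdM hbdP in
/-- `Q̃(x) = x^{−1/2} (T⁺(x) + T⁻(x))` for `x > 1`. [cite: IwaniecActaArith1980, §7 (p. 195)] -/
theorem candDiff_half_eq_of_lt {x : ℝ} (hx : 1 < x) :
    candDiff (1 / 2) 1 x = x ^ (-(1 / 2 : ℝ)) * (contTLim 1 (1 / 2) 1 x + contTLim 0 (1 / 2) 1 x) := by
  rw [candDiff, candUpper, candLower_eq_of_lt hx]; ring

/-- The derivative of `W = s^{1/2} Q̃` on `(1, 2)`: `W'(s) = −(1/2) s^{−1/2} Ã (s − 1)^{−1/2}`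
(`s^{1/2} F̃ = Ã` is constant there and `(s^{1/2} f̃)' = (1/2) s^{−1/2} F̃(s − 1)`). [folklore] -/
theorem hasDerivAt_rpow_mul_candDiff_half_of_lt {s : ℝ} (hs : 1 < s) (hs' : s < 1 + 1) :
    HasDerivAt (fun t : ℝ => t ^ (1 / 2 : ℝ) * candDiff (1 / 2) 1 t)
      (-((1 / 2 : ℝ) * s ^ ((1 / 2 : ℝ) - 1) * (candConst (1 / 2) 1 * (s - 1) ^ (-(1 / 2 : ℝ))))) s := by
  have hs0 : 0 < s := by linarith
  have hF : HasDerivAt (fun t : ℝ => t ^ (1 / 2 : ℝ) * candUpper (1 / 2) 1 t) 0 s := by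
    refine (hasDerivAt_const s (candConst (1 / 2) 1)).congr_of_eventuallyEq ?_
    filter_upwards [Ioo_mem_nhds hs0 hs'] with t ht
    rw [candUpper_half_eq hbdP ht.1 ht.2.le, ← mul_assoc, mul_comm (t ^ (1 / 2 : ℝ)), mul_assoc,
      Real.rpow_neg ht.1.le, mul_inv_cancel₀ (Real.rpow_pos_of_pos ht.1 _).ne', mul_one]
  have hf := hasDerivAt_candLower_half hbdM hbdP hs
  have hF1 : candUpper (1 / 2) 1 (s - 1) = candConst (1 / 2) 1 * (s - 1) ^ (-(1 / 2 : ℝ)) :=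
    candUpper_half_eq hbdP (by linarith) (by linarith)
  have h := hF.sub hf
  rw [hF1] at h
  refine (h.congr_of_eventuallyEq (Eventually.of_forall fun t => ?_)).congr_deriv (by ring)
  simp only [candDiff, mul_sub, Pi.sub_apply]

/-- The derivative of `W = s^{1/2} Q̃` on `(2, ∞)`: `W'(s) = −(1/2) s^{−1/2} Q̃(s − 1)`.
[cite: IwaniecActaArith1980, §7 (7.10)] -/
theorem hasDerivAt_rpow_mul_candDiff_half_of_gt {s : ℝ} (hs : 1 + 1 < s) :
    HasDerivAt (fun t : ℝ => t ^ (1 / 2 : ℝ) * candDiff (1 / 2) 1 t)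
      (-((1 / 2 : ℝ) * s ^ ((1 / 2 : ℝ) - 1) * candDiff (1 / 2) 1 (s - 1))) s := by
  have hF := hasDerivAt_candUpper_half hbdM hbdP hs
  have hf := hasDerivAt_candLower_half hbdM hbdP (by linarith : (1:ℝ) < s)
  refine ((hF.sub hf).congr_of_eventuallyEq (Eventually.of_forall fun t => ?_)).congr_deriv ?_
  · simp only [candDiff, mul_sub, Pi.sub_apply]
  · rw [candDiff]; ring

end HalfCandidate

/-! ### `B̃ = 0`: the pairing with the adjoint `g ≡ 1` of dimension `1/2` -/

section HalfBZero

variable {c : ℝ}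
  (hbdM : ∀ (N : ℕ) (u : ℝ), 1 ≤ u → contT 0 (1 / 2) 1 N u ≤ c * qLower 1 2 u)
  (hbdP : ∀ (N : ℕ) (u : ℝ), 0 ≤ u → contT 1 (1 / 2) 1 N u ≤ c * qUpper 1 2 u)
include hbdM hbdP

omit hbdM hbdP in
/-- A product `s · s^a · s^b = 1` when the exponents add up to `−1` (`s > 0`). [folklore] -/
theorem mul_rpow_mul_rpow_eq_one {s a b : ℝ} (hs : 0 < s) (h : 1 + a + b = 0) :
    s * s ^ a * s ^ b = 1 := by
  have h1 : s ^ (1:ℝ) * s ^ a * s ^ b = 1 := by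
    rw [← Real.rpow_add hs, ← Real.rpow_add hs, h, Real.rpow_zero]
  rwa [Real.rpow_one] at h1

omit hbdM hbdP in
/-- The adjoint `g ≡ 1` of dimension `1/2`: `(t · 1)' = 1/2 + 1/2`. [cite: Greaves2001, §4.2.3 (3.3)] -/
theorem hasDerivAt_mul_one_half (s : ℝ) :
    HasDerivAt (fun t : ℝ => t * (fun _ : ℝ => (1:ℝ)) t) ((1 / 2 : ℝ) * (fun _ : ℝ => (1:ℝ)) s +
      (1 / 2 : ℝ) * (fun _ : ℝ => (1:ℝ)) (s + 1)) s := by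
  have h := (hasDerivAt_id s).mul_const (1:ℝ)
  refine h.congr_deriv ?_
  norm_num

/-- **`⟨Q̃, 1⟩' = 0` beyond `2 = β + 1`** (the `Q`-equation `s Q̃' = −(1/2) Q̃(s) − (1/2) Q̃(s − 1)`
and the adjoint `g ≡ 1`). [cite: IwaniecActaArith1980, §7 (7.10)–(7.12)] -/
theorem hasDerivAt_innerProduct_half_of_gt {s : ℝ} (hs : 1 + 1 < s) :
    HasDerivAt (sieveInnerProduct (1 / 2) (candDiff (1 / 2) 1) (fun _ => (1:ℝ))) 0 s := by
  have hs0 : 0 < s := by linarith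
  have hW := hasDerivAt_rpow_mul_candDiff_half_of_gt hbdM hbdP hs
  have hR := hasDerivAt_candDiff hs0 hW
  have e1 : s * s ^ (-(1 / 2 : ℝ) - 1) * s ^ (1 / 2 : ℝ) = 1 :=
    mul_rpow_mul_rpow_eq_one hs0 (by norm_num)
  have e2 : s * s ^ (-(1 / 2 : ℝ)) * s ^ ((1 / 2 : ℝ) - 1) = 1 :=
    mul_rpow_mul_rpow_eq_one hs0 (by norm_num)
  refine hasDerivAt_sieveInnerProduct (a := 1 / 2) (d := 0) (by linarith) hR ?_
    (hasDerivAt_mul_one_half s) (continuousOn_const.mul (continuousOn_candDiff_half hbdM hbdP))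
  set Q := candDiff (1 / 2) 1 with hQ
  have : s * (-(1 / 2 : ℝ) * s ^ (-(1 / 2 : ℝ) - 1) * (s ^ (1 / 2 : ℝ) * Q s) +
      s ^ (-(1 / 2 : ℝ)) * -((1 / 2 : ℝ) * s ^ ((1 / 2 : ℝ) - 1) * Q (s - 1))) =
      -(1 / 2 : ℝ) * (s * s ^ (-(1 / 2 : ℝ) - 1) * s ^ (1 / 2 : ℝ)) * Q s -
        (1 / 2 : ℝ) * (s * s ^ (-(1 / 2 : ℝ)) * s ^ ((1 / 2 : ℝ) - 1)) * Q (s - 1) := by ring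
  rw [this, e1, e2]; ring

/-- **`⟨Q̃, 1⟩' = −(1/2) B̃ (s − 1)^{−1/2}` on `(1, 2)`** (there the `Q`-equation carries the
inhomogeneity `−(1/2) B̃ (s − 1)^{−1/2}`). [cite: IwaniecActaArith1980, §7 (7.10)–(7.12)] -/
theorem hasDerivAt_innerProduct_half_of_lt {s : ℝ} (hs : 1 < s) (hs' : s < 1 + 1) :
    HasDerivAt (sieveInnerProduct (1 / 2) (candDiff (1 / 2) 1) (fun _ => (1:ℝ)))
      ((fun _ : ℝ => (1:ℝ)) s * (-(1 / 2 : ℝ) * candB (1 / 2) 1 * (s - 1) ^ (-(1 / 2 : ℝ)))) s := by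
  have hs0 : 0 < s := by linarith
  have hW := hasDerivAt_rpow_mul_candDiff_half_of_lt hbdM hbdP hs hs'
  have hR := hasDerivAt_candDiff hs0 hW
  have e1 : s * s ^ (-(1 / 2 : ℝ) - 1) * s ^ (1 / 2 : ℝ) = 1 :=
    mul_rpow_mul_rpow_eq_one hs0 (by norm_num)
  have e2 : s * s ^ (-(1 / 2 : ℝ)) * s ^ ((1 / 2 : ℝ) - 1) = 1 :=
    mul_rpow_mul_rpow_eq_one hs0 (by norm_num)
  have hQ1 : candDiff (1 / 2) 1 (s - 1) =
      (candConst (1 / 2) 1 - candB (1 / 2) 1) * (s - 1) ^ (-(1 / 2 : ℝ)) :=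
    candDiff_half_eq_of_le hbdP (by linarith) (by linarith)
  refine hasDerivAt_sieveInnerProduct_inhom (a := 1 / 2) (d := 0) (by linarith) hR ?_
    (hasDerivAt_mul_one_half s) (continuousOn_const.mul (continuousOn_candDiff_half hbdM hbdP))
  rw [hQ1]
  set Q := candDiff (1 / 2) 1 with hQ
  have : s * (-(1 / 2 : ℝ) * s ^ (-(1 / 2 : ℝ) - 1) * (s ^ (1 / 2 : ℝ) * Q s) +
      s ^ (-(1 / 2 : ℝ)) * -((1 / 2 : ℝ) * s ^ ((1 / 2 : ℝ) - 1) *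
        (candConst (1 / 2) 1 * (s - 1) ^ (-(1 / 2 : ℝ))))) =
      -(1 / 2 : ℝ) * (s * s ^ (-(1 / 2 : ℝ) - 1) * s ^ (1 / 2 : ℝ)) * Q s -
        (1 / 2 : ℝ) * (s * s ^ (-(1 / 2 : ℝ)) * s ^ ((1 / 2 : ℝ) - 1)) *
          (candConst (1 / 2) 1 * (s - 1) ^ (-(1 / 2 : ℝ))) := by ring
  rw [this, e1, e2]; ring

/-- `⟨Q̃, 1⟩` is continuous at every `s > 1` (`Q̃` is continuous on `(0, ∞) ⊇ [s − 1, s]`).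
[folklore] -/
theorem continuousAt_innerProduct_half {s : ℝ} (hs : 1 < s) :
    ContinuousAt (sieveInnerProduct (1 / 2) (candDiff (1 / 2) 1) (fun _ => (1:ℝ))) s := by
  have hQc := continuousOn_candDiff_half hbdM hbdP
  have hprod : ContinuousOn (fun x => (fun _ : ℝ => (1:ℝ)) (x + 1) * candDiff (1 / 2) 1 x) (Ioi 0) :=
    continuousOn_const.mul hQc
  have h1 : ContinuousAt (fun t : ℝ => t * (fun _ : ℝ => (1:ℝ)) t * candDiff (1 / 2) 1 t) s :=
    ((continuousAt_id.mul continuousAt_const).mul (hQc.continuousAt (Ioi_mem_nhds (by linarith))))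
  have h2 : ContinuousAt (fun u => ∫ x in (u - 1)..u, (fun _ : ℝ => (1:ℝ)) (x + 1) * candDiff (1 / 2) 1 x) s :=
    (hasDerivAt_integral_sub_one (d := 0) (by linarith) hprod).continuousAt
  exact h1.sub (continuousAt_const.mul h2)

/-- **`Q̃ = O(e^{−s})`** at `β = 1` (`T^± ≤ c Z^±` and the super-exponential decay of the linear-sieve
majorants). [cite: IwaniecActaArith1980, Lemma 18] -/
theorem candDiff_half_isBigO :
    candDiff (1 / 2) 1 =O[atTop] fun s : ℝ => Real.exp (-s) := by
  have hc : 0 ≤ c := by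
    have h := hbdP 0 0 le_rfl
    rw [contT_zero_right, zUpper_eq (by norm_num)] at h
    linarith
  refine IsBigO.of_bound (c * 2) ?_
  filter_upwards [majorantHyp_one_two.eventually_qUpper_le 1, majorantHyp_one_two.eventually_qLower_le 1,
    eventually_gt_atTop (1:ℝ)] with x hqU hqL hx1
  have hx0 : 0 < x := by linarith
  have hTU : contTLim 1 (1 / 2) 1 x ≤ c * qUpper 1 2 x := contTLim_one_half_le hbdP hx0.le
  have hTL : contTLim 0 (1 / 2) 1 x ≤ c * qLower 1 2 x := contTLim_zero_half_le hbdM hx1.le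
  have hTU0 : 0 ≤ contTLim 1 (1 / 2) 1 x := contTLim_one_half_nonneg hbdP hx0.le
  have hTL0 : 0 ≤ contTLim 0 (1 / 2) 1 x := contTLim_zero_half_nonneg hbdM hx1.le
  have hxκ : x ^ (-(1 / 2 : ℝ)) ≤ 1 := Real.rpow_le_one_of_one_le_of_nonpos hx1.le (by norm_num)
  have hxκ0 : 0 ≤ x ^ (-(1 / 2 : ℝ)) := Real.rpow_nonneg hx0.le _
  rw [candDiff_half_eq_of_lt hx1, Real.norm_eq_abs, Real.norm_eq_abs, abs_of_nonneg (Real.exp_pos _).le,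
    abs_of_nonneg (mul_nonneg hxκ0 (add_nonneg hTU0 hTL0))]
  simp only [one_mul] at hqU hqL
  calc x ^ (-(1 / 2 : ℝ)) * (contTLim 1 (1 / 2) 1 x + contTLim 0 (1 / 2) 1 x)
      ≤ 1 * (c * qUpper 1 2 x + c * qLower 1 2 x) :=
        mul_le_mul hxκ (add_le_add hTU hTL) (add_nonneg hTU0 hTL0) zero_le_one
    _ = c * (qUpper 1 2 x + qLower 1 2 x) := by ring
    _ ≤ c * (Real.exp (-x) + Real.exp (-x)) := mul_le_mul_of_nonneg_left (add_le_add hqU hqL) hc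
    _ = c * 2 * Real.exp (-x) := by ring

/-- **`⟨Q̃, 1⟩(s) → 0`** as `s → ∞`. [cite: IwaniecActaArith1980, §7 (p. 196)] -/
theorem tendsto_innerProduct_half_zero :
    Tendsto (sieveInnerProduct (1 / 2) (candDiff (1 / 2) 1) (fun _ => (1:ℝ))) atTop (𝓝 0) := by
  refine tendsto_sieveInnerProduct_zero (N := 0) (candDiff_half_isBigO hbdM hbdP) ?_
  exact IsBigO.of_bound 1 (Eventually.of_forall fun s => by simp)

/-- **`⟨Q̃, 1⟩ = 0` on `[2, ∞)`** (constant beyond `2` and tending to `0`). [cite: IwaniecActaArith1980, §7 (p. 196)] -/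
theorem innerProduct_half_eq_zero {u : ℝ} (hu : 1 + 1 ≤ u) :
    sieveInnerProduct (1 / 2) (candDiff (1 / 2) 1) (fun _ => (1:ℝ)) u = 0 := by
  set I := sieveInnerProduct (1 / 2) (candDiff (1 / 2) 1) (fun _ => (1:ℝ)) with hI
  have hconst : ∀ v, u ≤ v → I v = I u := by
    intro v huv
    rcases eq_or_lt_of_le huv with h | h
    · rw [h]
    · refine eq_of_hasDerivAt_zero_Ioo h (fun x hx => ?_) fun x hx => ?_
      · exact (continuousAt_innerProduct_half hbdM hbdP (by linarith [hx.1])).continuousWithinAt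
      · exact hasDerivAt_innerProduct_half_of_gt hbdM hbdP (by linarith [hx.1])
  have hev : I =ᶠ[atTop] fun _ => I u := by
    filter_upwards [eventually_ge_atTop u] with v hv using hconst v hv
  exact tendsto_nhds_unique ((tendsto_innerProduct_half_zero hbdM hbdP).congr' hev) tendsto_const_nhds
    |>.symm

/-- **`⟨Q̃, 1⟩(s) = B̃ (1 − (s − 1)^{1/2})` on `(1, 2)`** (integrating the derivative down from `2`).
[cite: IwaniecActaArith1980, §7 (7.12)] -/
theorem innerProduct_half_eq_of_mem {s : ℝ} (hs : 1 < s) (hs' : s < 1 + 1) :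
    sieveInnerProduct (1 / 2) (candDiff (1 / 2) 1) (fun _ => (1:ℝ)) s =
      candB (1 / 2) 1 * (1 - (s - 1) ^ (1 / 2 : ℝ)) := by
  set I := sieveInnerProduct (1 / 2) (candDiff (1 / 2) 1) (fun _ => (1:ℝ)) with hI
  set J : ℝ → ℝ := fun u => I u + candB (1 / 2) 1 * (u - 1) ^ (1 / 2 : ℝ) with hJ
  have hJc : ContinuousOn J (Icc s (1 + 1)) := by
    intro u hu
    have hu1 : 1 < u := by linarith [hu.1]
    refine ContinuousAt.continuousWithinAt ?_
    exact (continuousAt_innerProduct_half hbdM hbdP hu1).add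
      (continuousAt_const.mul (((continuousAt_id.sub continuousAt_const).rpow_const
        (Or.inr (by norm_num)))))
  have hJd : ∀ u ∈ Ioo s (1 + 1), HasDerivAt J 0 u := by
    intro u hu
    have hu1 : 1 < u := by linarith [hu.1]
    have h1 := hasDerivAt_innerProduct_half_of_lt hbdM hbdP hu1 hu.2
    have h2 : HasDerivAt (fun v : ℝ => (v - 1) ^ (1 / 2 : ℝ)) ((1 / 2 : ℝ) * (u - 1) ^ ((1 / 2 : ℝ) - 1)) u := by
      simpa using ((hasDerivAt_id u).sub_const 1).rpow_const (p := (1 / 2 : ℝ))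
        (Or.inl (sub_ne_zero.mpr hu1.ne'))
    refine (h1.add (h2.const_mul (candB (1 / 2) 1))).congr_deriv ?_
    rw [show (1 / 2 : ℝ) - 1 = -(1 / 2 : ℝ) by norm_num]
    ring
  have hJeq := eq_of_hasDerivAt_zero_Ioo hs' hJc hJd
  have hI2 : I (1 + 1) = 0 := innerProduct_half_eq_zero hbdM hbdP le_rfl
  simp only [hJ, hI2, zero_add] at hJeq
  rw [show (1 + 1 - 1 : ℝ) = 1 by norm_num, Real.one_rpow, mul_one] at hJeq
  show I s = candB (1 / 2) 1 * (1 - (s - 1) ^ (1 / 2 : ℝ))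
  linarith

omit hbdM in
/-- The explicit integral `∫_{s−1}^1 Q̃ = 2 (Ã − B̃)(1 − (s − 1)^{1/2})` for `1 < s ≤ 2`.
[cite: IwaniecActaArith1980, §7 (7.12)] -/
theorem integral_candDiff_half_eq {s : ℝ} (hs : 1 < s) (hs' : s ≤ 1 + 1) :
    ∫ x in (s - 1)..1, candDiff (1 / 2) 1 x =
      2 * (candConst (1 / 2) 1 - candB (1 / 2) 1) * (1 - (s - 1) ^ (1 / 2 : ℝ)) := by
  have h1 : ∫ x in (s - 1)..1, candDiff (1 / 2) 1 x =
      ∫ x in (s - 1)..1, (candConst (1 / 2) 1 - candB (1 / 2) 1) * x ^ (-(1 / 2 : ℝ)) := by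
    refine intervalIntegral.integral_congr fun x hx => ?_
    rw [uIcc_of_le (by linarith)] at hx
    exact candDiff_half_eq_of_le hbdP (by linarith [hx.1]) hx.2
  rw [h1, intervalIntegral.integral_const_mul, integral_rpow (Or.inl (by norm_num))]
  rw [show (-(1 / 2 : ℝ) + 1) = 1 / 2 by norm_num, Real.one_rpow]
  ring

/-- **`B̃ = 0` at `β = 1`**: comparing `⟨Q̃, 1⟩(s) = B̃ (1 − (s − 1)^{1/2})` with the direct
evaluation `⟨Q̃, 1⟩(s) = s Q̃(s) − (Ã − B̃)(1 − (s − 1)^{1/2}) − (1/2) ∫_1^s Q̃` as `s → 1⁺`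
(`s Q̃(s) → T⁺(1) + T⁻(1) = Ã − B̃`). [cite: IwaniecActaArith1980, §7 (p. 196)] -/
theorem candB_half_eq_zero : candB (1 / 2) 1 = 0 := by
  set Q := candDiff (1 / 2) 1 with hQdef
  set I := sieveInnerProduct (1 / 2) Q (fun _ => (1:ℝ)) with hI
  set A' := candConst (1 / 2) 1 with hA'
  set B' := candB (1 / 2) 1 with hB'
  have hQc : ContinuousOn Q (Ioi 0) := continuousOn_candDiff_half hbdM hbdP
  have hQint : ∀ a b, 0 < a → 0 < b → IntervalIntegrable Q volume a b := by
    intro a b ha hb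
    refine (hQc.mono fun x hx => ?_).intervalIntegrable
    rcases le_total a b with hab | hab
    · rw [uIcc_of_le hab] at hx; exact show (0:ℝ) < x by linarith [hx.1]
    · rw [uIcc_of_ge hab] at hx; exact show (0:ℝ) < x by linarith [hx.1]
  -- the identity on `(1, 2)`
  have hident : ∀ s ∈ Ioo (1:ℝ) (1 + 1), B' * (1 - (s - 1) ^ (1 / 2 : ℝ)) =
      s * Q s - (A' - B') * (1 - (s - 1) ^ (1 / 2 : ℝ)) - (1 / 2) * ∫ x in (1:ℝ)..s, Q x := by
    intro s hs
    have h1 : I s = B' * (1 - (s - 1) ^ (1 / 2 : ℝ)) := by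
      rw [hI, hQdef, hB']; exact innerProduct_half_eq_of_mem hbdM hbdP hs.1 hs.2
    have h2 : I s = s * Q s - (1 / 2) * ∫ x in (s - 1)..s, Q x := by
      simp only [hI, sieveInnerProduct, mul_one, one_mul]
    have h3 : ∫ x in (s - 1)..s, Q x = (∫ x in (s - 1)..1, Q x) + ∫ x in (1:ℝ)..s, Q x :=
      (intervalIntegral.integral_add_adjacent_intervals (hQint _ _ (by linarith [hs.1]) one_pos)
        (hQint _ _ one_pos (by linarith [hs.1]))).symm
    have h4 : ∫ x in (s - 1)..1, Q x = 2 * (A' - B') * (1 - (s - 1) ^ (1 / 2 : ℝ)) := by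
      rw [hQdef, hA', hB']; exact integral_candDiff_half_eq hbdP hs.1 hs.2.le
    rw [← h1, h2, h3, h4]
    ring
  -- limits as `s → 1⁺`
  have hpow : Tendsto (fun s : ℝ => (s - 1) ^ (1 / 2 : ℝ)) (𝓝[>] 1) (𝓝 0) := by
    have hc : ContinuousAt (fun s : ℝ => (s - 1) ^ (1 / 2 : ℝ)) 1 :=
      (continuousAt_id.sub continuousAt_const).rpow_const (Or.inr (by norm_num))
    have h := hc.tendsto
    rw [show ((1:ℝ) - 1) ^ (1 / 2 : ℝ) = 0 by norm_num] at h
    exact h.mono_left nhdsWithin_le_nhds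
  have hL : Tendsto (fun s : ℝ => B' * (1 - (s - 1) ^ (1 / 2 : ℝ))) (𝓝[>] 1) (𝓝 B') := by
    have h := (tendsto_const_nhds (x := B')).mul ((tendsto_const_nhds (x := (1:ℝ))).sub hpow)
    rw [sub_zero, mul_one] at h
    exact h
  -- `s Q(s) → Ã − B̃`
  have hTp : Tendsto (contTLim 1 (1 / 2) 1) (𝓝[>] 1) (𝓝 (A' - 1)) := by
    have hc : ContinuousAt (contTLim 1 (1 / 2) 1) 1 :=
      (continuousOn_contTLim_one_half hbdM hbdP).continuousAt (Ioi_mem_nhds one_pos)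
    have hval : contTLim 1 (1 / 2) 1 1 = A' - 1 := by
      rw [contTLim_one_half_eq_of_le hbdP one_pos (by norm_num), hA', candConst, Real.one_rpow]; ring
    rw [← hval]
    exact hc.tendsto.mono_left nhdsWithin_le_nhds
  have hTm : Tendsto (contTLim 0 (1 / 2) 1) (𝓝[>] 1) (𝓝 (1 - B')) := by
    have hc : ContinuousWithinAt (contTLim 0 (1 / 2) 1) (Ici 1) 1 :=
      continuousOn_contTLim_zero_half hbdM hbdP 1 self_mem_Ici
    have hval : contTLim 0 (1 / 2) 1 1 = 1 - B' := by
      rw [hB', candB, Real.one_rpow]; ring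
    rw [← hval]
    exact hc.tendsto.mono_left (nhdsWithin_mono _ Ioi_subset_Ici_self)
  have hsQ : Tendsto (fun s : ℝ => s * Q s) (𝓝[>] 1) (𝓝 (A' - B')) := by
    have hrp : Tendsto (fun s : ℝ => s ^ (-(1 / 2 : ℝ))) (𝓝[>] 1) (𝓝 1) := by
      have hc : ContinuousAt (fun s : ℝ => s ^ (-(1 / 2 : ℝ))) 1 :=
        Real.continuousAt_rpow_const 1 _ (Or.inl one_ne_zero)
      have h := hc.tendsto
      rw [Real.one_rpow] at h
      exact h.mono_left nhdsWithin_le_nhds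
    have hid : Tendsto (fun s : ℝ => s) (𝓝[>] 1) (𝓝 1) :=
      (continuousAt_id).tendsto.mono_left nhdsWithin_le_nhds
    have h := hid.mul (hrp.mul (hTp.add hTm))
    have hlim : (1:ℝ) * (1 * (A' - 1 + (1 - B'))) = A' - B' := by ring
    rw [hlim] at h
    refine h.congr' ?_
    filter_upwards [self_mem_nhdsWithin] with s (hs : 1 < s)
    rw [hQdef, candDiff_half_eq_of_lt hs]
  -- `∫_1^s Q → 0`
  have hP : Tendsto (fun s : ℝ => ∫ x in (1:ℝ)..s, Q x) (𝓝[>] 1) (𝓝 0) := by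
    have hint : IntegrableOn Q (uIcc 1 (1 + 1)) volume := by
      rw [uIcc_of_le (by norm_num)]
      exact (hQc.mono fun x hx => show (0:ℝ) < x by linarith [hx.1]).integrableOn_compact isCompact_Icc
    have hc := intervalIntegral.continuousOn_primitive_interval hint
    rw [uIcc_of_le (by norm_num)] at hc
    have h := (hc 1 ⟨le_rfl, by norm_num⟩).tendsto
    simp only [intervalIntegral.integral_same] at h
    have h' := h.mono_left (nhdsWithin_mono (1:ℝ) (Ioc_subset_Icc_self : Ioc (1:ℝ) (1 + 1) ⊆ Icc 1 (1 + 1)))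
    rwa [nhdsWithin_Ioc_eq_nhdsGT (by norm_num : (1:ℝ) < 1 + 1)] at h'
  have hR : Tendsto (fun s : ℝ => s * Q s - (A' - B') * (1 - (s - 1) ^ (1 / 2 : ℝ)) -
      (1 / 2) * ∫ x in (1:ℝ)..s, Q x) (𝓝[>] 1) (𝓝 0) := by
    have h := (hsQ.sub ((tendsto_const_nhds (x := A' - B')).mul
      ((tendsto_const_nhds (x := (1:ℝ))).sub hpow))).sub (hP.const_mul (1 / 2))
    have hlim : A' - B' - (A' - B') * (1 - 0) - 1 / 2 * 0 = (0:ℝ) := by ring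
    rwa [hlim] at h
  have hev : (fun s : ℝ => B' * (1 - (s - 1) ^ (1 / 2 : ℝ))) =ᶠ[𝓝[>] 1] fun s =>
      s * Q s - (A' - B') * (1 - (s - 1) ^ (1 / 2 : ℝ)) - (1 / 2) * ∫ x in (1:ℝ)..s, Q x := by
    have hmem : Ioo (1:ℝ) (1 + 1) ∈ 𝓝[>] (1:ℝ) := Ioo_mem_nhdsGT (by norm_num)
    filter_upwards [hmem] with s hs using hident s hs
  exact tendsto_nhds_unique (hL.congr' hev) hR

end HalfBZero

/-! ### Identification with the greatest data of dimension `1/2` and Lemma 18 at `κ = 1/2` -/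

section HalfAssembly

variable {c : ℝ}
  (hbdM : ∀ (N : ℕ) (u : ℝ), 1 ≤ u → contT 0 (1 / 2) 1 N u ≤ c * qLower 1 2 u)
  (hbdP : ∀ (N : ℕ) (u : ℝ), 0 ≤ u → contT 1 (1 / 2) 1 N u ≤ c * qUpper 1 2 u)
include hbdM hbdP

omit hbdM in
/-- **Normalisation of `F̃` at `β = 1`**: `F̃(s) − 1 = s^{−1/2} T⁺(s) = O(e^{−s})`.
[cite: IwaniecActaArith1980, Lemma 18 and (6.5)] -/
theorem candUpper_half_isBigO :
    (fun s : ℝ => candUpper (1 / 2) 1 s - 1) =O[atTop] fun s : ℝ => Real.exp (-s) := by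
  have hc : 0 ≤ c := by
    have h := hbdP 0 0 le_rfl
    rw [contT_zero_right, zUpper_eq (by norm_num)] at h
    linarith
  refine IsBigO.of_bound c ?_
  filter_upwards [majorantHyp_one_two.eventually_qUpper_le 1, eventually_ge_atTop (1:ℝ)] with s hq hs1
  have hs0 : 0 < s := by linarith
  have hT0 : 0 ≤ contTLim 1 (1 / 2) 1 s := contTLim_one_half_nonneg hbdP hs0.le
  have hT : contTLim 1 (1 / 2) 1 s ≤ c * qUpper 1 2 s := contTLim_one_half_le hbdP hs0.le
  have hsk : s ^ (-(1 / 2 : ℝ)) ≤ 1 := Real.rpow_le_one_of_one_le_of_nonpos hs1 (by norm_num)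
  have hsk0 : 0 ≤ s ^ (-(1 / 2 : ℝ)) := Real.rpow_nonneg hs0.le _
  simp only [one_mul] at hq
  rw [candUpper, add_sub_cancel_left, Real.norm_eq_abs, Real.norm_eq_abs,
    abs_of_nonneg (Real.exp_pos _).le, abs_of_nonneg (mul_nonneg hsk0 hT0)]
  calc s ^ (-(1 / 2 : ℝ)) * contTLim 1 (1 / 2) 1 s ≤ 1 * (c * qUpper 1 2 s) :=
        mul_le_mul hsk hT hT0 zero_le_one
    _ ≤ c * Real.exp (-s) := by rw [one_mul]; exact mul_le_mul_of_nonneg_left hq hc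

omit hbdP in
/-- **Normalisation of `f̃` at `β = 1`**: `f̃(s) − 1 = −s^{−1/2} T⁻(s) = O(e^{−s})`.
[cite: IwaniecActaArith1980, Lemma 18 and (6.5)] -/
theorem candLower_half_isBigO (hbdP : ∀ (N : ℕ) (u : ℝ), 0 ≤ u → contT 1 (1 / 2) 1 N u ≤ c * qUpper 1 2 u) :
    (fun s : ℝ => candLower (1 / 2) 1 s - 1) =O[atTop] fun s : ℝ => Real.exp (-s) := by
  have hc : 0 ≤ c := by
    have h := hbdP 0 0 le_rfl
    rw [contT_zero_right, zUpper_eq (by norm_num)] at h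
    linarith
  refine IsBigO.of_bound c ?_
  filter_upwards [majorantHyp_one_two.eventually_qLower_le 1, eventually_gt_atTop (1:ℝ)] with s hq hs1
  have hs0 : 0 < s := by linarith
  have hT0 : 0 ≤ contTLim 0 (1 / 2) 1 s := contTLim_zero_half_nonneg hbdM hs1.le
  have hT : contTLim 0 (1 / 2) 1 s ≤ c * qLower 1 2 s := contTLim_zero_half_le hbdM hs1.le
  have hsk : s ^ (-(1 / 2 : ℝ)) ≤ 1 := Real.rpow_le_one_of_one_le_of_nonpos hs1.le (by norm_num)
  have hsk0 : 0 ≤ s ^ (-(1 / 2 : ℝ)) := Real.rpow_nonneg hs0.le _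
  simp only [one_mul] at hq
  rw [candLower_eq_of_lt hs1, Real.norm_eq_abs, Real.norm_eq_abs, abs_of_nonneg (Real.exp_pos _).le,
    show (1 : ℝ) - s ^ (-(1 / 2 : ℝ)) * contTLim 0 (1 / 2) 1 s - 1 =
      -(s ^ (-(1 / 2 : ℝ)) * contTLim 0 (1 / 2) 1 s) by ring,
    abs_neg, abs_of_nonneg (mul_nonneg hsk0 hT0)]
  calc s ^ (-(1 / 2 : ℝ)) * contTLim 0 (1 / 2) 1 s ≤ 1 * (c * qLower 1 2 s) :=
        mul_le_mul hsk hT hT0 zero_le_one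
    _ ≤ c * Real.exp (-s) := by rw [one_mul]; exact mul_le_mul_of_nonneg_left hq hc

/-- **The candidates solve the half-dimensional `β`-sieve system**: `IsBetaSieveSolution (1/2) F̃ f̃ 1 Ã`
((1.8)–(1.9) with `β = 1`, `B = 0`, and the normalisation).
[cite: IwaniecActaArith1980, Lemma 18 and p. 202] -/
theorem isBetaSieveSolution_cand_half :
    IsBetaSieveSolution (1 / 2) (candUpper (1 / 2) 1) (candLower (1 / 2) 1) 1 (candConst (1 / 2) 1) := by
  have hB0 := candB_half_eq_zero hbdM hbdP
  exact
    { one_le := le_rfl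
      pos := candConst_half_pos hbdP
      upper_eq := fun s hs => candUpper_half_eq hbdP hs.1 hs.2
      lower_eq := fun s hs => by rw [candLower_eq_of_le hs.2, hB0, zero_mul]
      hasDerivAt_upper := fun s hs => hasDerivAt_candUpper_half hbdM hbdP hs
      hasDerivAt_lower := fun s hs => hasDerivAt_candLower_half hbdM hbdP hs
      continuousOn_upper := continuousOn_candUpper_half hbdM hbdP
      continuousOn_lower := continuousOn_candLower_half hbdM hbdP
      upper_isBigO := candUpper_half_isBigO hbdP
      lower_isBigO := candLower_half_isBigO hbdM hbdP }

/-- **Lemma 18 at `κ = 1/2` for a normalised solution with `β = 1`**: identification by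
`IsBetaSieveSolution.unique_of_beta_eq`, then `T^±_N ≤ T^±` (`T⁺ = s^{1/2}(F − 1)`,
`T⁻ = s^{1/2}(1 − f)`, and `T⁻(1) = 1` since `B̃ = 0`). [cite: IwaniecActaArith1980, Lemma 18] -/
theorem lemma18_half_of_isBetaSieveSolution {F f : ℝ → ℝ} {A : ℝ}
    (h : IsBetaSieveSolution (1 / 2) F f 1 A) (N : ℕ) (s : ℝ) :
    (1 + 1 ≤ s → contT 1 (1 / 2) 1 N s ≤ s ^ (1 / 2 : ℝ) * (F s - 1)) ∧
      (1 ≤ s → contT 0 (1 / 2) 1 N s ≤ s ^ (1 / 2 : ℝ) * (1 - f s)) := by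
  obtain ⟨-, hF, hf⟩ := h.unique_of_beta_eq (isBetaSieveSolution_cand_half hbdM hbdP)
  have hB0 := candB_half_eq_zero hbdM hbdP
  constructor
  · intro hs
    have hs0 : 0 < s := by linarith
    rw [hF hs0, candUpper, add_sub_cancel_left, ← mul_assoc, ← Real.rpow_add hs0, add_neg_cancel,
      Real.rpow_zero, one_mul]
    exact contT_le_contTLim 1 (fun N => hbdP N s hs0.le) N
  · intro hs
    have hs0 : 0 < s := by linarith
    rw [hf hs0]
    rcases eq_or_lt_of_le hs with h1 | h1
    · subst h1
      rw [candLower_eq_of_le le_rfl, hB0, zero_mul, sub_zero, mul_one, Real.one_rpow]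
      have hT : contTLim 0 (1 / 2) 1 1 = 1 := by
        have := hB0; rw [candB, Real.one_rpow] at this; linarith
      have h1 := contT_le_contTLim 0 (fun N => hbdM N _ le_rfl) N
      linarith [h1, hT]
    · rw [candLower_eq_of_lt h1, sub_sub_cancel, ← mul_assoc, ← Real.rpow_add hs0, add_neg_cancel,
        Real.rpow_zero, one_mul]
      exact contT_le_contTLim 0 (fun N => hbdM N s hs) N

end HalfAssembly

/-- **Iwaniec's Lemma 18 in dimension `1/2` (`Iwaniec1980_lemma18_half`) holds**: for the greatest
`β`-sieve data `(F, f, β, A)` of dimension `1/2` (so `β = 1`, `IsBetaSieveSolution.beta_eq_one`),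
`T⁺_N(s) ≤ s^{1/2} (F(s) − 1)` for `s ≥ β + 1` and `T⁻_N(s) ≤ s^{1/2} (1 − f(s))` for `s ≥ β`, for
every `N`. The majorant bounds come from `exists_const_contT_le_half` (Lemma 17 at `κ = 1/2` with the
linear-sieve majorants). [cite: IwaniecActaArith1980, Lemma 18] -/
theorem Iwaniec1980_lemma18_half_holds : Iwaniec1980_lemma18_half := by
  intro B hB N s
  obtain ⟨F, f, β, A⟩ := B
  have hsol : IsBetaSieveSolution (1 / 2) F f β A := hB.1
  have hβ : β = 1 := hsol.beta_eq_one
  subst hβ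
  obtain ⟨c, -, hc⟩ := exists_const_contT_le_half
  exact lemma18_half_of_isBetaSieveSolution (fun N u hu => (hc N).1 u hu) (fun N u hu => (hc N).2 u hu)
    hsol N s

/-- **`Iwaniec1980_lemma18` holds** (the named fact of `RosserSieveSums.lean`, for all `κ ≥ 1/2`):
`κ > 1/2` by `BetaSieve.lemma18` (`RosserSieveLemma14.lean`), `κ = 1/2` by
`Iwaniec1980_lemma18_half_holds`. [cite: IwaniecActaArith1980, Lemma 18] -/
theorem Iwaniec1980_lemma18_holds : Iwaniec1980_lemma18 :=
  Iwaniec1980_lemma18_of_half Iwaniec1980_lemma18_half_holds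

end BetaSieve

/-- **Iwaniec's main-term lower bound from Lemma 20 alone.** [cite: IwaniecActaArith1980, Thm 1 with (1.6)] -/
theorem Iwaniec1980_lemma20.mainTerm_lower (h20 : Iwaniec1980_lemma20) : Iwaniec1980_mainTerm_lower :=
  BetaSieve.Iwaniec1980_mainTerm_lower_of_lemma20 BetaSieve.Iwaniec1980_lemma18_half_holds h20

/-- **Iwaniec's main-term upper bound from Lemma 20 alone.** [cite: IwaniecActaArith1980, Thm 1 with (1.7)] -/
theorem Iwaniec1980_lemma20.mainTerm_upper (h20 : Iwaniec1980_lemma20) : Iwaniec1980_mainTerm_upper :=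
  BetaSieve.Iwaniec1980_mainTerm_upper_of_lemma20 BetaSieve.Iwaniec1980_lemma18_half_holds h20

/-- **Iwaniec's Theorem 1 (printed `y`-form), lower bound, from Lemma 20 alone.**
[cite: IwaniecActaArith1980, Thm 1 with (1.6)] -/
theorem Iwaniec1980_lemma20.thm1_lower (h20 : Iwaniec1980_lemma20) : Iwaniec1980_thm1_lower :=
  Iwaniec1980_thm1_lower_of_mainTerm h20.mainTerm_lower

/-- **Iwaniec's Theorem 1 (printed `y`-form), upper bound, from Lemma 20 alone.**
[cite: IwaniecActaArith1980, Thm 1 with (1.7)] -/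
theorem Iwaniec1980_lemma20.thm1_upper (h20 : Iwaniec1980_lemma20) : Iwaniec1980_thm1_upper :=
  Iwaniec1980_thm1_upper_of_mainTerm h20.mainTerm_upper

/-- **The corrected lower-bound sieve theorem `SieveSequence.Iwaniec1980_lower` from Lemma 20 alone**
(the faithful form of the misstated `SieveSequence.jurkat_richert_lower`).
[cite: IwaniecActaArith1980, Thm 1 with (1.6)] -/
theorem Iwaniec1980_lemma20.sieveSequence_lower (h20 : Iwaniec1980_lemma20) :
    SieveSequence.Iwaniec1980_lower :=
  SieveSequence.Iwaniec1980_lower_of_lemma20 BetaSieve.Iwaniec1980_lemma18_half_holds h20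

/-- **The corrected upper-bound sieve theorem `SieveSequence.Iwaniec1980_upper` from Lemma 20 alone.**
[cite: IwaniecActaArith1980, Thm 1 with (1.7)] -/
theorem Iwaniec1980_lemma20.sieveSequence_upper (h20 : Iwaniec1980_lemma20) :
    SieveSequence.Iwaniec1980_upper :=
  SieveSequence.Iwaniec1980_upper_of_lemma20 BetaSieve.Iwaniec1980_lemma18_half_holds h20

end Literature.NumberTheory.Sieve
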